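import Mathlib
import HarnessLib
import Summits.ValiantsHypothesis.ValiantsHypothesis.Theorems.MonotoneRestorationOrbitRestorationQPInjectivePlacementsTwoSided
import Summits.ValiantsHypothesis.ValiantsHypothesis.Theorems.MonotoneRestorationOrbitRestorationQPNarrowSpanNewton

/-!
# Orbit products of local affine forms are narrow with treewidth `≤ r + c + 1` (SPAN currency; untwisted `ΠΣ`)

Route MonotoneRestoration, crux `OrbitRestorationQP` (stmt-ValiantsHypothesis-18293), SPAN-currency lane of the open
sub-rung A_∞ (`stub_sigmaPiSigmaValue`); evidence note `SPAN-CURRENCY-A1-g7g4.md` §2 Steps 3–7, §5.  Helper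
(`--supports`), def-free.  With INJ landed (`…InjectivePlacements(TwoSided).lean`) and Newton in span currency
(`…NarrowSpanNewton.lean`), the untwisted `ΠΣ` mechanism closes:

* **`prod_injPlacements_affineLocalForm_mem_narrowSpan`** — for every local affine datum `(β₀, δ, α, β, γ)` on the core
  `Fin r × Fin c` and every `n`, the product of `β₀ + δU + ℓ^{φ,ψ}` over ALL pairs of injective placements
  `φ : Fin r ↪ [n]`, `ψ : Fin c ↪ [n]` lies in `span_ℂ {hom_{F,n} : tw F ≤ r + c + 1}` — an explicit matrix-symmetric
  `ΠΣ` class with `(n)_r (n)_c` factors of full width (generalising the cross-local, row-local and two-row-local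
  products and the row-sum discriminant of the sibling files), with CONSTANT treewidth, hence polynomial orbits;
* **`prod_mem_narrowSpan_of_psum_eq_injPlacements`** — THE ORBIT FORM: any finite family `(L_i)` whose power sums are a
  fixed positive multiple `s⁻¹` of the injective-placement power sums of a local affine datum (this is what an UNTWISTED
  line-orbit of a matrix-symmetric affine product is, by `LocalFactors.exists_rowColSupports_of_matrixSymmetric`, with
  `s` = the number of placements per line) has `Π_i L_i ∈ span_ℂ {hom_{F,n} : tw F ≤ r + c + 1}`.

What remains for the untwisted `ΠΣ` theorem stated on `IsMatrixSymmetric` families: the bookkeeping that a matrix-symmetric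
affine product splits into line-orbits of this form (structure theorem + untwisted normalisation; note §2 Steps 1–2).
Honest label: a mechanism-complete sub-class; the stub, the crux and VP ≠ VNP are not moved.
-/

noncomputable section

-- `Summit.ValiantsHypothesis.ValiantsHypothesis.…` is the tree's single-conjunct layout (Sub = Summit).
set_option linter.dupNamespace false

namespace Summit.ValiantsHypothesis.ValiantsHypothesis.Theorems

namespace CorePatterns

open MvPolynomial Finset
open Literature.Computability.AlgebraicComplexity (homPoly)
open Literature.Combinatorics.SimpleGraph (treewidth)

/-- The injective-placement power sums, indexed by the subtype of injective placement pairs. [folklore] -/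
theorem sum_subtype_injPlacements_pow_mem_narrowSpan (n r c k : ℕ) (β₀ δ : ℂ) (α : Fin r × Fin c → ℂ)
    (β : Fin r → ℂ) (γ : Fin c → ℂ) :
    (∑ p : {p : (Fin r → Fin n) × (Fin c → Fin n) // Function.Injective p.1 ∧ Function.Injective p.2},
      ((C β₀ + C δ * ∑ i : Fin n, ∑ j : Fin n, (X (i, j) : MvPolynomial (Fin n × Fin n) ℂ)) +
        ((∑ ab : Fin r × Fin c, C (α ab) * (X (p.1.1 ab.1, p.1.2 ab.2) : MvPolynomial (Fin n × Fin n) ℂ)) +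
          (∑ a : Fin r, C (β a) * ∑ j : Fin n, (X (p.1.1 a, j) : MvPolynomial (Fin n × Fin n) ℂ)) +
          (∑ b : Fin c, C (γ b) * ∑ j : Fin n, (X (j, p.1.2 b) : MvPolynomial (Fin n × Fin n) ℂ)))) ^ k) ∈
    Submodule.span ℂ {p : MvPolynomial (Fin n × Fin n) ℂ |
        ∃ (a b : ℕ) (E : Multiset (Fin a × Fin b)),
          treewidth (SimpleGraph.fromRel fun u v : Fin a ⊕ Fin b =>
            ∃ e ∈ E, u = Sum.inl e.1 ∧ v = Sum.inr e.2) ≤ r + c + 1 ∧ p = homPoly E n ℂ} := by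
  classical
  have h := sum_injective_injective_pow_affineLocalForm_mem_narrowSpan n r c k β₀ δ α β γ
  rw [← Finset.sum_product' (s := (univ : Finset (Fin r → Fin n)).filter fun φ => Function.Injective φ)
    (t := (univ : Finset (Fin c → Fin n)).filter fun ψ => Function.Injective ψ)
    (f := fun φ ψ => ((C β₀ + C δ * ∑ i : Fin n, ∑ j : Fin n, (X (i, j) : MvPolynomial (Fin n × Fin n) ℂ)) +
        ((∑ ab : Fin r × Fin c, C (α ab) * (X (φ ab.1, ψ ab.2) : MvPolynomial (Fin n × Fin n) ℂ)) +
          (∑ a : Fin r, C (β a) * ∑ j : Fin n, (X (φ a, j) : MvPolynomial (Fin n × Fin n) ℂ)) +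
          (∑ b : Fin c, C (γ b) * ∑ j : Fin n, (X (j, ψ b) : MvPolynomial (Fin n × Fin n) ℂ)))) ^ k),
    ← Finset.filter_product, Finset.univ_product_univ] at h
  rw [Finset.sum_subtype (((univ : Finset ((Fin r → Fin n) × (Fin c → Fin n))).filter
      fun p => Function.Injective p.1 ∧ Function.Injective p.2))
      (p := fun p : (Fin r → Fin n) × (Fin c → Fin n) => Function.Injective p.1 ∧ Function.Injective p.2)
      (fun p => by simp)] at h
  exact h

/-- **Products of a local affine form over ALL injective placements are narrow, treewidth `≤ r + c + 1`.**
[folklore; cite: DwivediPagoSeppelt2026, §8] -/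
theorem prod_injPlacements_affineLocalForm_mem_narrowSpan (n r c : ℕ) (β₀ δ : ℂ) (α : Fin r × Fin c → ℂ)
    (β : Fin r → ℂ) (γ : Fin c → ℂ) :
    (∏ p : {p : (Fin r → Fin n) × (Fin c → Fin n) // Function.Injective p.1 ∧ Function.Injective p.2},
      ((C β₀ + C δ * ∑ i : Fin n, ∑ j : Fin n, (X (i, j) : MvPolynomial (Fin n × Fin n) ℂ)) +
        ((∑ ab : Fin r × Fin c, C (α ab) * (X (p.1.1 ab.1, p.1.2 ab.2) : MvPolynomial (Fin n × Fin n) ℂ)) +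
          (∑ a : Fin r, C (β a) * ∑ j : Fin n, (X (p.1.1 a, j) : MvPolynomial (Fin n × Fin n) ℂ)) +
          (∑ b : Fin c, C (γ b) * ∑ j : Fin n, (X (j, p.1.2 b) : MvPolynomial (Fin n × Fin n) ℂ))))) ∈
    Submodule.span ℂ {p : MvPolynomial (Fin n × Fin n) ℂ |
        ∃ (a b : ℕ) (E : Multiset (Fin a × Fin b)),
          treewidth (SimpleGraph.fromRel fun u v : Fin a ⊕ Fin b =>
            ∃ e ∈ E, u = Sum.inl e.1 ∧ v = Sum.inr e.2) ≤ r + c + 1 ∧ p = homPoly E n ℂ} :=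
  NarrowSpanNewton.prod_mem_narrowSpan_of_psum_mem n (r + c + 1) _ fun k =>
    sum_subtype_injPlacements_pow_mem_narrowSpan n r c k β₀ δ α β γ

/-- **THE ORBIT FORM.**  If the power sums of a finite family `(L_i)` are `s⁻¹` times the injective-placement power sums
of a local affine datum (`s ≥ 1` placements per line: the shape of an UNTWISTED line-orbit of a matrix-symmetric affine
product), then `Π_i L_i ∈ span_ℂ {hom_{F,n} : tw F ≤ r + c + 1}`. [folklore; cite: DwivediPagoSeppelt2026, §8] -/
theorem prod_mem_narrowSpan_of_psum_eq_injPlacements (n r c : ℕ) (β₀ δ : ℂ) (α : Fin r × Fin c → ℂ)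
    (β : Fin r → ℂ) (γ : Fin c → ℂ) {ι : Type} [Fintype ι] (L : ι → MvPolynomial (Fin n × Fin n) ℂ)
    (s : ℕ) (hs : s ≠ 0)
    (h : ∀ k : ℕ, s • (∑ i, L i ^ k) =
      ∑ p : {p : (Fin r → Fin n) × (Fin c → Fin n) // Function.Injective p.1 ∧ Function.Injective p.2},
        ((C β₀ + C δ * ∑ i : Fin n, ∑ j : Fin n, (X (i, j) : MvPolynomial (Fin n × Fin n) ℂ)) +
          ((∑ ab : Fin r × Fin c, C (α ab) * (X (p.1.1 ab.1, p.1.2 ab.2) : MvPolynomial (Fin n × Fin n) ℂ)) +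
            (∑ a : Fin r, C (β a) * ∑ j : Fin n, (X (p.1.1 a, j) : MvPolynomial (Fin n × Fin n) ℂ)) +
            (∑ b : Fin c, C (γ b) * ∑ j : Fin n, (X (j, p.1.2 b) : MvPolynomial (Fin n × Fin n) ℂ)))) ^ k) :
    (∏ i, L i) ∈ Submodule.span ℂ {p : MvPolynomial (Fin n × Fin n) ℂ |
        ∃ (a b : ℕ) (E : Multiset (Fin a × Fin b)),
          treewidth (SimpleGraph.fromRel fun u v : Fin a ⊕ Fin b =>
            ∃ e ∈ E, u = Sum.inl e.1 ∧ v = Sum.inr e.2) ≤ r + c + 1 ∧ p = homPoly E n ℂ} := by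
  refine NarrowSpanNewton.prod_mem_narrowSpan_of_psum_mem n (r + c + 1) L fun k => ?_
  have hk := sum_subtype_injPlacements_pow_mem_narrowSpan n r c k β₀ δ α β γ
  rw [← h k] at hk
  have hs' : ((s : ℕ) : ℂ) ≠ 0 := by exact_mod_cast hs
  have : (∑ i, L i ^ k) = ((s : ℕ) : ℂ)⁻¹ • (s • ∑ i, L i ^ k) := by
    rw [← Nat.cast_smul_eq_nsmul ℂ, inv_smul_smul₀ hs']
  rw [this]
  exact Submodule.smul_mem _ _ hk

end CorePatterns

end Summit.ValiantsHypothesis.ValiantsHypothesis.Theorems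

end
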